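import Literature.NumberTheory.Rogawski1990.ArchDeltaTransferOfChartRead      -- ★ p850246 (LH7-p01 (g2)) R0: the anisotropic-frame READ `isArchDeltaTransfer_of_chart_read` and all its kit
import Literature.NumberTheory.Rogawski1990.ArchCompatibleFamiliesGDet         -- ★ #104 (R90-C131-p02 (g2)): `ArchCompatibleFamiliesGDet` = print's measure convention with `det ≠ 0` in place of anisotropy
import HarnessLib

/-!
# READ at a NON-DEGENERATE diagonal frame (`α_i ≠ 0`, no anisotropy): chart readings agreeing on the regular sets give the archimedean `Δ″_∞`-transfer identity —
# the `hα`-twin of ★ `isArchDeltaTransfer_of_chart_read` (J-ShelQS refit (R-b1); Rogawski 1990 §4.3 (4.3.1), §14.3; Shelstad 1979 §4)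

Topic `NumberTheory/Rogawski1990`; namespace `Literature.NumberTheory.Rogawski1990`.  THEOREMS ONLY (no `def`, no instance, no notation, no axiom, no named fact, no
`sorry`); kernel lane `--kind proof --supports stmt-HodgeConjecture-24833`.  Cell `pub/hodgecm-mathlib`, crux h413 = `stmt-HodgeConjecture-24833`; S10 dealer
R90-C138-plan (g4) J-ShelQS REFIT (R56∕R68, 2026-09-05T04:01Z), item (R-b1); author K2E4-p23 (g4).

WHY.  Organ READ (h4) of the kernel-checked N9″ road (`Cruxes/H413/Lines/F0_P3c_StubN9Direct.lean`, `stub_N9read := isArchDeltaTransfer_of_chart_read`) is stated in the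
ANISOTROPIC house frame (`hherm`, `hanis`) of the inner form `G′ = U(diag α)`, because the closer row `stub_N9` serves the anisotropic `G′`.  Its proof reads `hanis`
EXACTLY TWICE: as `hα : ∀ i, α i ≠ 0 := ne_zero_of_diagonal_anisotropic hanis` and as `Godement.det_ne_zero_of_anisotropic … hanis` (the `det ≠ 0` fed to ★
`archStableCentralizerEquiv` inside (C′)).  The QUASI-SPLIT group `G_∞ = U(Φ₃)_∞` — where `hShelQS` (the archimedean Δ-transfer EXISTENCE that T2's frame and S10's
`sock_S10_archFamiliesJR6LE` consume) lives — is the SAME atlas at the ISOTROPIC diagonal frame `β = (½, 1, −½)` (★ `formCongr_quasiSplitFrame_diagonal`), where `hherm` ✓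
and `hα` ✓ (★ `quasiSplitWeights_ne_zero`) but `hanis` ✗ (a ternary hermitian form over a CM field is anisotropic iff definite at some real place).  This file is the
`hα`-TWIN of READ, in the pattern of the N8-INNER road's ★ `ArchHCOrbitalFamiliesNondeg` ∕ `ArchOrbFamGExtJumpNondeg` ∕ `ArchOrbFamGExtJumpSideGNondeg` (CUT B):
STATEMENT = the ★ statement token for token but for the binder (`hanis ↦ hα`) and the measure-convention predicate (★ `ArchCompatibleFamiliesG … hanis …` ↦ ★
`ArchCompatibleFamiliesGDet … (det_diagonal_ne_zero_of_ne_zero hα) …`, the same clauses by ★ `archCompatibleFamiliesG_iff_det`); PROOF = the ★ body verbatim with the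
line `have hα := …` deleted and the `Godement` det term replaced by `det_diagonal_ne_zero_of_ne_zero hα` — zero new analysis.
* `det_diagonal_ne_zero_of_ne_zero` — `(∀ i, α i ≠ 0) → (diagonal α).det ≠ 0` (`Matrix.det_diagonal`).
* **`isArchDeltaTransfer_of_chart_read_of_ne_zero`** — READ at `hα`: if on every `H`-chart `S` the stable orbital family of `f_H` agrees with `Transf_{Δ″}` of the orbital
  family of `a′` on `RegS S`, then `f_H` is a `Δ″_∞`-transfer of `a′` (★ `IsArchDeltaTransfer`), for det-convention families ((W′)(W)(C′)(C)(C′G), ★ `ArchCompatibleFamiliesGDet`)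
  and ★ `ArchCompatibleFamiliesH`.
HONEST LABEL: count-neutral plumbing; pays `hShelQS` only through the head (R-c) once ★, and pays no printed input; HC_CM is proved only modulo the 7 printed citations
(2 remaining: hLiu418 = `stmt-HodgeConjecture-24832`, h413 = `stmt-HodgeConjecture-24833`) until rung 0 closes.

## References
* [Rogawski1990] J. D. Rogawski, *Automorphic Representations of Unitary Groups in Three Variables*, Ann. of Math. Stud. 123 (1990), §4.3 (4.3.1) p. 43; §14.3 pp. 233–234.
* [Shelstad1979] D. Shelstad, *Characters and inner forms of a quasi-split group over ℝ*, Compositio Math. 39 (1979), §4 pp. 20–23.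
* [Bouaziz1994IntegralesOrbitales] A. Bouaziz, *Intégrales orbitales sur les groupes de Lie réductifs*, Ann. Sci. ÉNS 27 (1994), Rem. 2 p. 594.
-/

set_option autoImplicit false

noncomputable section

open MeasureTheory MeasureTheory.Measure NumberField NumberField.InfinitePlace Matrix Complex Topology
open Literature.MeasureTheory.Group
open scoped MatrixGroups Matrix Classical NNReal ENNReal

namespace Literature.NumberTheory.Rogawski1990

open Literature.NumberTheory.Automorphic Literature.NumberTheory.Automorphic.UnitaryGroup Literature.NumberTheory.Automorphic.ArchCartan
open Literature.NumberTheory.GaloisRepresentations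

/-! ## §1 The determinant of a non-degenerate diagonal frame -/

/-- `α_i ≠ 0` for all `i` ⇒ `det (diag α) ≠ 0` (`det (diag α) = ∏ α_i`). [cite: Rogawski1990, §1.9 p. 8] -/
theorem det_diagonal_ne_zero_of_ne_zero {L : Type} [Field L] {α : Fin 3 → L} (hα : ∀ i, α i ≠ 0) : (Matrix.diagonal α).det ≠ 0 := by
  rw [Matrix.det_diagonal]
  exact Finset.prod_ne_zero_iff.2 fun i _ => hα i

/-! ## §2 READ at a non-degenerate diagonal frame -/

/-- **READ AT A NON-DEGENERATE DIAGONAL FRAME (`hα : ∀ i, α i ≠ 0`; no anisotropy)** — the `hα`-twin of ★ `isArchDeltaTransfer_of_chart_read`: in the diagonal frame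
`H′ = diag α` (hermitian, `α_i ≠ 0`), for Haar measures `ν′, ν, νH`, a unitary `μ` restricting to `ω_{L∕L⁺}`, conjugation-invariance witnesses `hl, hr` of `Δ″_∞`, measure
families in print's det-convention (★ `ArchCompatibleFamiliesGDet`, ★ `ArchCompatibleFamiliesH`) and test functions `a′`, `f_H`: if on EVERY `H`-chart `S` the stable orbital family
of `f_H` agrees with «`Transf_{Δ″}`» of the ordinary orbital family of `a′` on `RegS S`, then `f_H` is a `Δ″_∞`-transfer of `a′` (★ `IsArchDeltaTransfer`).  Same telescope
(★ `isArchDeltaTransfer_of_forall_chart` + ★ `stableOrbitalIntegralRel_endoTorus_eq_finsum_of_read`), verbatim; the anisotropic ★ head is this statement at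
`hα := ne_zero_of_diagonal_anisotropic hanis` through ★ `archCompatibleFamiliesG_iff_det`.
[cite: Rogawski1990, §4.3 (4.3.1) p. 43; §14.3 pp. 233–234] [cite: Shelstad1979, §4 pp. 20–23] [cite: Bouaziz1994IntegralesOrbitales, Rem. 2 p. 594] -/
theorem isArchDeltaTransfer_of_chart_read_of_ne_zero :
  ∀ (L : Type) [Field L] [NumberField L] [IsCMField L] (α : Fin 3 → L)
    [MeasurableSpace ↥(UnitaryGroup.arch (↥(maximalRealSubfield L)) L (IsCMField.complexConj L) 3 (Matrix.diagonal α))] [BorelSpace ↥(UnitaryGroup.arch (↥(maximalRealSubfield L)) L (IsCMField.complexConj L) 3 (Matrix.diagonal α))] [MeasurableSpace ↥(UnitaryGroup.arch (↥(maximalRealSubfield L)) L (IsCMField.complexConj L) 3 (Matrix.of fun i j : Fin 3 => if i.val + j.val + 1 = 3 then (1 : L) else 0))] [BorelSpace ↥(UnitaryGroup.arch (↥(maximalRealSubfield L)) L (IsCMField.complexConj L) 3 (Matrix.of fun i j : Fin 3 => if i.val + j.val + 1 = 3 then (1 : L) else 0))] [MeasurableSpace (UnitaryGroup.arch (↥(maximalRealSubfield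 L)) L (IsCMField.complexConj L) 2 (Matrix.of fun i j : Fin 2 => if i.val + j.val + 1 = 2 then (1 : L) else 0) × UnitaryGroup.arch (↥(maximalRealSubfield L)) L (IsCMField.complexConj L) 1 (Matrix.of fun i j : Fin 1 => if i.val + j.val + 1 = 1 then (1 : L) else 0))] [BorelSpace (UnitaryGroup.arch (↥(maximalRealSubfield L)) L (IsCMField.complexConj L) 2 (Matrix.of fun i j : Fin 2 => if i.val + j.val + 1 = 2 then (1 : L) else 0) × UnitaryGroup.arch (↥(maximalRealSubfield L)) L (IsCMField.complexConj L) 1 (Matrix.of fun i j : Fin 1 => if i.val + j.val + 1 = 1 then (1 : L) else 0))]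
    (ν' : Measure ↥(UnitaryGroup.arch (↥(maximalRealSubfield L)) L (IsCMField.complexConj L) 3 (Matrix.diagonal α))) (ν : Measure ↥(UnitaryGroup.arch (↥(maximalRealSubfield L)) L (IsCMField.complexConj L) 3 (Matrix.of fun i j : Fin 3 => if i.val + j.val + 1 = 3 then (1 : L) else 0))) (νH : Measure (UnitaryGroup.arch (↥(maximalRealSubfield L)) L (IsCMField.complexConj L) 2 (Matrix.of fun i j : Fin 2 => if i.val + j.val + 1 = 2 then (1 : L) else 0) × UnitaryGroup.arch (↥(maximalRealSubfield L)) L (IsCMField.complexConj L) 1 (Matrix.of fun i j : Fin 1 => if i.val + j.val + 1 = 1 then (1 : L) else 0)))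
    [ν'.IsHaarMeasure] [ν'.IsMulRightInvariant] [ν.IsHaarMeasure] [ν.IsMulRightInvariant] [νH.IsHaarMeasure] [νH.IsMulRightInvariant]
    (μ : HeckeCharacter L) (_hμu : μ.IsUnitary)
    (_hμω : ∀ x : Literature.NumberTheory.GaloisRepresentations.ideleGroup ↥(maximalRealSubfield L), μ (AdeleRing.ideleBaseChange (↥(maximalRealSubfield L)) L x) = quadraticHeckeCharCM L x)
    (hl : ∀ (a : (UnitaryGroup.arch (↥(maximalRealSubfield L)) L (IsCMField.complexConj L) 2 (Matrix.of fun i j : Fin 2 => if i.val + j.val + 1 = 2 then (1 : L) else 0) × UnitaryGroup.arch (↥(maximalRealSubfield L)) L (IsCMField.complexConj L) 1 (Matrix.of fun i j : Fin 1 => if i.val + j.val + 1 = 1 then (1 : L) else 0))) (b : ↥(UnitaryGroup.arch (↥(maximalRealSubfield L)) L (IsCMField.complexConj L) 3 (Matrix.diagonal α))) (x : (UnitaryGroup.arch (↥(maximalRealSubfield L)) L (IsCMField.complexConj L) 2 (Matrix.of fun i j : Fin 2 => if i.val + j.val + 1 = 2 then (1 : L) else 0) × UnitaryGroup.arch (↥(maximalRealSubfield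 L)) L (IsCMField.complexConj L) 1 (Matrix.of fun i j : Fin 1 => if i.val + j.val + 1 = 1 then (1 : L) else 0))),
      archExplicitDelta L (Matrix.diagonal α) (x * a * x⁻¹) μ b = archExplicitDelta L (Matrix.diagonal α) a μ b)
    (hr : ∀ (a : (UnitaryGroup.arch (↥(maximalRealSubfield L)) L (IsCMField.complexConj L) 2 (Matrix.of fun i j : Fin 2 => if i.val + j.val + 1 = 2 then (1 : L) else 0) × UnitaryGroup.arch (↥(maximalRealSubfield L)) L (IsCMField.complexConj L) 1 (Matrix.of fun i j : Fin 1 => if i.val + j.val + 1 = 1 then (1 : L) else 0))) (b y : ↥(UnitaryGroup.arch (↥(maximalRealSubfield L)) L (IsCMField.complexConj L) 3 (Matrix.diagonal α))),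
      archExplicitDelta L (Matrix.diagonal α) a μ (y * b * y⁻¹) = archExplicitDelta L (Matrix.diagonal α) a μ b),
    ((Matrix.diagonal α).map (cmConjRingHom L)).transpose = Matrix.diagonal α →
      ∀ hα : (∀ i, α i ≠ 0),
        letI : ∀ γ : ↥(UnitaryGroup.arch (↥(maximalRealSubfield L)) L (IsCMField.complexConj L) 3 (Matrix.diagonal α)), MeasurableSpace (↥(UnitaryGroup.arch (↥(maximalRealSubfield L)) L (IsCMField.complexConj L) 3 (Matrix.diagonal α)) ⧸ Subgroup.centralizer ({γ} : Set ↥(UnitaryGroup.arch (↥(maximalRealSubfield L)) L (IsCMField.complexConj L) 3 (Matrix.diagonal α)))) := fun _ => borel _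
        haveI : ∀ γ : ↥(UnitaryGroup.arch (↥(maximalRealSubfield L)) L (IsCMField.complexConj L) 3 (Matrix.diagonal α)), BorelSpace (↥(UnitaryGroup.arch (↥(maximalRealSubfield L)) L (IsCMField.complexConj L) 3 (Matrix.diagonal α)) ⧸ Subgroup.centralizer ({γ} : Set ↥(UnitaryGroup.arch (↥(maximalRealSubfield L)) L (IsCMField.complexConj L) 3 (Matrix.diagonal α)))) := fun _ => ⟨rfl⟩
        letI : ∀ γ : ↥(UnitaryGroup.arch (↥(maximalRealSubfield L)) L (IsCMField.complexConj L) 3 (Matrix.of fun i j : Fin 3 => if i.val + j.val + 1 = 3 then (1 : L) else 0)), MeasurableSpace (↥(UnitaryGroup.arch (↥(maximalRealSubfield L)) L (IsCMField.complexConj L) 3 (Matrix.of fun i j : Fin 3 => if i.val + j.val + 1 = 3 then (1 : L) else 0)) ⧸ Subgroup.centralizer ({γ} : Set ↥(UnitaryGroup.arch (↥(maximalRealSubfield L)) L (IsCMField.complexConj L) 3 (Matrix.of fun i j : Fin 3 => if i.val + j.val + 1 = 3 then (1 : L) else 0)))) := fun _ => borel _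
        haveI : ∀ γ : ↥(UnitaryGroup.arch (↥(maximalRealSubfield L)) L (IsCMField.complexConj L) 3 (Matrix.of fun i j : Fin 3 => if i.val + j.val + 1 = 3 then (1 : L) else 0)), BorelSpace (↥(UnitaryGroup.arch (↥(maximalRealSubfield L)) L (IsCMField.complexConj L) 3 (Matrix.of fun i j : Fin 3 => if i.val + j.val + 1 = 3 then (1 : L) else 0)) ⧸ Subgroup.centralizer ({γ} : Set ↥(UnitaryGroup.arch (↥(maximalRealSubfield L)) L (IsCMField.complexConj L) 3 (Matrix.of fun i j : Fin 3 => if i.val + j.val + 1 = 3 then (1 : L) else 0)))) := fun _ => ⟨rfl⟩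
        letI : ∀ a : (UnitaryGroup.arch (↥(maximalRealSubfield L)) L (IsCMField.complexConj L) 2 (Matrix.of fun i j : Fin 2 => if i.val + j.val + 1 = 2 then (1 : L) else 0) × UnitaryGroup.arch (↥(maximalRealSubfield L)) L (IsCMField.complexConj L) 1 (Matrix.of fun i j : Fin 1 => if i.val + j.val + 1 = 1 then (1 : L) else 0)), MeasurableSpace ((UnitaryGroup.arch (↥(maximalRealSubfield L)) L (IsCMField.complexConj L) 2 (Matrix.of fun i j : Fin 2 => if i.val + j.val + 1 = 2 then (1 : L) else 0) × UnitaryGroup.arch (↥(maximalRealSubfield L)) L (IsCMField.complexConj L) 1 (Matrix.of fun i j : Fin 1 => if i.val + j.val + 1 = 1 then (1 : L) else 0)) ⧸ Subgroup.centralizer ({a} : Set (UnitaryGroup.arch (↥(maximalRealSubfield L)) L (IsCMField.complexConj L) 2 (Matrix.of fun i j : Fin 2 => if i.val + j.val + 1 = 2 then (1 : L) else 0) × UnitaryGroup.arch (↥(maximalRealSubfield L)) L (IsCMField.complexConj L) 1 (Matrix.of fun i j : Fin 1 => if i.val + j.val + 1 = 1 then (1 : L) else 0)))) := fun _ => borel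 _
        haveI : ∀ a : (UnitaryGroup.arch (↥(maximalRealSubfield L)) L (IsCMField.complexConj L) 2 (Matrix.of fun i j : Fin 2 => if i.val + j.val + 1 = 2 then (1 : L) else 0) × UnitaryGroup.arch (↥(maximalRealSubfield L)) L (IsCMField.complexConj L) 1 (Matrix.of fun i j : Fin 1 => if i.val + j.val + 1 = 1 then (1 : L) else 0)), BorelSpace ((UnitaryGroup.arch (↥(maximalRealSubfield L)) L (IsCMField.complexConj L) 2 (Matrix.of fun i j : Fin 2 => if i.val + j.val + 1 = 2 then (1 : L) else 0) × UnitaryGroup.arch (↥(maximalRealSubfield L)) L (IsCMField.complexConj L) 1 (Matrix.of fun i j : Fin 1 => if i.val + j.val + 1 = 1 then (1 : L) else 0)) ⧸ Subgroup.centralizer ({a} : Set (UnitaryGroup.arch (↥(maximalRealSubfield L)) L (IsCMField.complexConj L) 2 (Matrix.of fun i j : Fin 2 => if i.val + j.val + 1 = 2 then (1 : L) else 0) × UnitaryGroup.arch (↥(maximalRealSubfield L)) L (IsCMField.complexConj L) 1 (Matrix.of fun i j : Fin 1 => if i.val + j.val + 1 = 1 then (1 : L) else 0)))) := fun _ =>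 ⟨rfl⟩
        ∀ (m' : OrbitalMeasureFamily ↥(UnitaryGroup.arch (↥(maximalRealSubfield L)) L (IsCMField.complexConj L) 3 (Matrix.diagonal α))) (m : OrbitalMeasureFamily ↥(UnitaryGroup.arch (↥(maximalRealSubfield L)) L (IsCMField.complexConj L) 3 (Matrix.of fun i j : Fin 3 => if i.val + j.val + 1 = 3 then (1 : L) else 0))) (mH : OrbitalMeasureFamily (UnitaryGroup.arch (↥(maximalRealSubfield L)) L (IsCMField.complexConj L) 2 (Matrix.of fun i j : Fin 2 => if i.val + j.val + 1 = 2 then (1 : L) else 0) × UnitaryGroup.arch (↥(maximalRealSubfield L)) L (IsCMField.complexConj L) 1 (Matrix.of fun i j : Fin 1 => if i.val + j.val + 1 = 1 then (1 : L) else 0)))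
          (t' : ∀ γ' : ↥(UnitaryGroup.arch (↥(maximalRealSubfield L)) L (IsCMField.complexConj L) 3 (Matrix.diagonal α)), Measure (Subgroup.centralizer ({γ'} : Set ↥(UnitaryGroup.arch (↥(maximalRealSubfield L)) L (IsCMField.complexConj L) 3 (Matrix.diagonal α)))))
          (t : ∀ γ : ↥(UnitaryGroup.arch (↥(maximalRealSubfield L)) L (IsCMField.complexConj L) 3 (Matrix.of fun i j : Fin 3 => if i.val + j.val + 1 = 3 then (1 : L) else 0)), Measure (Subgroup.centralizer ({γ} : Set ↥(UnitaryGroup.arch (↥(maximalRealSubfield L)) L (IsCMField.complexConj L) 3 (Matrix.of fun i j : Fin 3 => if i.val + j.val + 1 = 3 then (1 : L) else 0)))))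
          (tH : ∀ γH : (UnitaryGroup.arch (↥(maximalRealSubfield L)) L (IsCMField.complexConj L) 2 (Matrix.of fun i j : Fin 2 => if i.val + j.val + 1 = 2 then (1 : L) else 0) × UnitaryGroup.arch (↥(maximalRealSubfield L)) L (IsCMField.complexConj L) 1 (Matrix.of fun i j : Fin 1 => if i.val + j.val + 1 = 1 then (1 : L) else 0)), Measure (Subgroup.centralizer ({γH} : Set (UnitaryGroup.arch (↥(maximalRealSubfield L)) L (IsCMField.complexConj L) 2 (Matrix.of fun i j : Fin 2 => if i.val + j.val + 1 = 2 then (1 : L) else 0) × UnitaryGroup.arch (↥(maximalRealSubfield L)) L (IsCMField.complexConj L) 1 (Matrix.of fun i j : Fin 1 => if i.val + j.val + 1 = 1 then (1 : L) else 0))))),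
          ArchCompatibleFamiliesGDet L (Matrix.diagonal α) ν' ν (det_diagonal_ne_zero_of_ne_zero hα) m' m t' t → ArchCompatibleFamiliesH L νH mH tH t →
            ∀ (a' : ↥(UnitaryGroup.arch (↥(maximalRealSubfield L)) L (IsCMField.complexConj L) 3 (Matrix.diagonal α)) → ℂ) (fH : (UnitaryGroup.arch (↥(maximalRealSubfield L)) L (IsCMField.complexConj L) 2 (Matrix.of fun i j : Fin 2 => if i.val + j.val + 1 = 2 then (1 : L) else 0) × UnitaryGroup.arch (↥(maximalRealSubfield L)) L (IsCMField.complexConj L) 1 (Matrix.of fun i j : Fin 1 => if i.val + j.val + 1 = 1 then (1 : L) else 0)) → ℂ), ArchSmooth L 3 (Matrix.diagonal α) a' → ArchSmooth₂ L fH →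
              (∀ S : Finset {w : InfinitePlace L // IsComplex w}, Set.EqOn (stOrbFamH L νH fH S) (transfFam L α μ (orbFamG L α ν' a') S) (RegS S)) →
                IsArchDeltaTransfer L (Matrix.diagonal α) (archExplicitTransferFactor L (Matrix.diagonal α) μ hl hr) mH m' fH a' := by
  intro L _ _ _ α _ _ _ _ _ _ ν' ν νH _ _ _ _ _ _ μ _hμu _hμω hl hr hherm hα
  letI : ∀ γ : ↥(UnitaryGroup.arch (↥(maximalRealSubfield L)) L (IsCMField.complexConj L) 3 (Matrix.diagonal α)), MeasurableSpace (↥(UnitaryGroup.arch (↥(maximalRealSubfield L)) L (IsCMField.complexConj L) 3 (Matrix.diagonal α)) ⧸ Subgroup.centralizer ({γ} : Set ↥(UnitaryGroup.arch (↥(maximalRealSubfield L)) L (IsCMField.complexConj L) 3 (Matrix.diagonal α)))) := fun _ => borel _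
  haveI : ∀ γ : ↥(UnitaryGroup.arch (↥(maximalRealSubfield L)) L (IsCMField.complexConj L) 3 (Matrix.diagonal α)), BorelSpace (↥(UnitaryGroup.arch (↥(maximalRealSubfield L)) L (IsCMField.complexConj L) 3 (Matrix.diagonal α)) ⧸ Subgroup.centralizer ({γ} : Set ↥(UnitaryGroup.arch (↥(maximalRealSubfield L)) L (IsCMField.complexConj L) 3 (Matrix.diagonal α)))) := fun _ => ⟨rfl⟩
  letI : ∀ γ : ↥(UnitaryGroup.arch (↥(maximalRealSubfield L)) L (IsCMField.complexConj L) 3 (Matrix.of fun i j : Fin 3 => if i.val + j.val + 1 = 3 then (1 : L) else 0)), MeasurableSpace (↥(UnitaryGroup.arch (↥(maximalRealSubfield L)) L (IsCMField.complexConj L) 3 (Matrix.of fun i j : Fin 3 => if i.val + j.val + 1 = 3 then (1 : L) else 0)) ⧸ Subgroup.centralizer ({γ} : Set ↥(UnitaryGroup.arch (↥(maximalRealSubfield L)) L (IsCMField.complexConj L) 3 (Matrix.of fun i j : Fin 3 => if i.val + j.val + 1 = 3 then (1 : L) else 0)))) := fun _ => borel _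
  haveI : ∀ γ : ↥(UnitaryGroup.arch (↥(maximalRealSubfield L)) L (IsCMField.complexConj L) 3 (Matrix.of fun i j : Fin 3 => if i.val + j.val + 1 = 3 then (1 : L) else 0)), BorelSpace (↥(UnitaryGroup.arch (↥(maximalRealSubfield L)) L (IsCMField.complexConj L) 3 (Matrix.of fun i j : Fin 3 => if i.val + j.val + 1 = 3 then (1 : L) else 0)) ⧸ Subgroup.centralizer ({γ} : Set ↥(UnitaryGroup.arch (↥(maximalRealSubfield L)) L (IsCMField.complexConj L) 3 (Matrix.of fun i j : Fin 3 => if i.val + j.val + 1 = 3 then (1 : L) else 0)))) := fun _ => ⟨rfl⟩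
  letI : ∀ a : (UnitaryGroup.arch (↥(maximalRealSubfield L)) L (IsCMField.complexConj L) 2 (Matrix.of fun i j : Fin 2 => if i.val + j.val + 1 = 2 then (1 : L) else 0) × UnitaryGroup.arch (↥(maximalRealSubfield L)) L (IsCMField.complexConj L) 1 (Matrix.of fun i j : Fin 1 => if i.val + j.val + 1 = 1 then (1 : L) else 0)), MeasurableSpace ((UnitaryGroup.arch (↥(maximalRealSubfield L)) L (IsCMField.complexConj L) 2 (Matrix.of fun i j : Fin 2 => if i.val + j.val + 1 = 2 then (1 : L) else 0) × UnitaryGroup.arch (↥(maximalRealSubfield L)) L (IsCMField.complexConj L) 1 (Matrix.of fun i j : Fin 1 => if i.val + j.val + 1 = 1 then (1 : L) else 0)) ⧸ Subgroup.centralizer ({a} : Set (UnitaryGroup.arch (↥(maximalRealSubfield L)) L (IsCMField.complexConj L) 2 (Matrix.of fun i j : Fin 2 => if i.val + j.val + 1 = 2 then (1 : L) else 0) × UnitaryGroup.arch (↥(maximalRealSubfield L)) L (IsCMField.complexConj L) 1 (Matrix.of fun i j : Fin 1 => if i.val + j.val + 1 = 1 then (1 : L) else 0)))) := fun _ => borel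 _
  haveI : ∀ a : (UnitaryGroup.arch (↥(maximalRealSubfield L)) L (IsCMField.complexConj L) 2 (Matrix.of fun i j : Fin 2 => if i.val + j.val + 1 = 2 then (1 : L) else 0) × UnitaryGroup.arch (↥(maximalRealSubfield L)) L (IsCMField.complexConj L) 1 (Matrix.of fun i j : Fin 1 => if i.val + j.val + 1 = 1 then (1 : L) else 0)), BorelSpace ((UnitaryGroup.arch (↥(maximalRealSubfield L)) L (IsCMField.complexConj L) 2 (Matrix.of fun i j : Fin 2 => if i.val + j.val + 1 = 2 then (1 : L) else 0) × UnitaryGroup.arch (↥(maximalRealSubfield L)) L (IsCMField.complexConj L) 1 (Matrix.of fun i j : Fin 1 => if i.val + j.val + 1 = 1 then (1 : L) else 0)) ⧸ Subgroup.centralizer ({a} : Set (UnitaryGroup.arch (↥(maximalRealSubfield L)) L (IsCMField.complexConj L) 2 (Matrix.of fun i j : Fin 2 => if i.val + j.val + 1 = 2 then (1 : L) else 0) × UnitaryGroup.arch (↥(maximalRealSubfield L)) L (IsCMField.complexConj L) 1 (Matrix.of fun i j : Fin 1 => if i.val + j.val + 1 = 1 then (1 : L) else 0)))) := fun _ =>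 ⟨rfl⟩
  intro m' m mH t' t tH hG hH a' fH _ha' _hfH hread
  -- readings of the frame
  have hhermα : ∀ i, (IsCMField.complexConj L (α i) : L) = α i := complexConj_apply_eq_of_diagonal_frame hherm
  have hreal : ∀ (w : {w : InfinitePlace L // IsComplex w}) (i : Fin 3), (w.1.embedding (α i)).im = 0 := fun w i => im_embedding_diagonal_eq_zero L 3 α hhermα w i
  obtain ⟨hW', -, hC', hC, hC'G⟩ := hG
  obtain ⟨hWH, hCH⟩ := hH
  -- reduce to the chart points (both sides are class functions; ★ (EXH-H)), then read each chart point
  exact isArchDeltaTransfer_of_forall_chart L (archExplicitTransferFactor L (Matrix.diagonal α) μ hl hr) (fun a b x => hl a b x) mH m' fH a'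
    fun S c hc => stableOrbitalIntegralRel_endoTorus_eq_finsum_of_read L α ν' νH m' mH t' t tH
      (det_diagonal_ne_zero_of_ne_zero hα) (UnitaryGroup.isUnit_antidiagOne_det L 3).ne_zero
      hW' hC' hC hC'G hCH hWH μ hl hr hα hhermα hreal a' fH S c hc (hread S (ArchCartan.regG_subset_regS S hc))

end Literature.NumberTheory.Rogawski1990

end
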